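import Summits.ABC.IUTFork.Repair.RHTameBandLicenceSigmaBall
import Summits.ABC.IUTFork.Cor312ProvKRamified
import HarnessLib

/-!
# R-H ROUND 2, SLICE / Q3 row 5: the SCOPE of Σ₅ (and of the ball scope Σ₅♭) EMPTIES at every bad prime `p ≤ l + 1` (resp. `p ≤ l`) —
# «vacuous for l ≫ 0» by theorem: over `K = F(E_F[l], …)` every bad place has `e_w ≥ l`

Seat abc-iut-rh-typ-5 (R-H PAIR n = 5 TYPER, gen 4; round-2 row-5 hand). PROOF-ONLY (0 definitions, nothing re-typed) over this seat's
`RH.TameBandLicenceSigma.sigmaFive` / `UniformlyTameAt` (p472055) and `RH.TameBandLicenceSigmaBall.sigmaFiveBall` / `UniformlyBallAt` (p473920),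
composing BY NAME abc-iut-w5-d054's `Cor312Prov.l_le_ramificationIdx_int_of_over_VFbad` (`Cor312ProvKRamified`: at every place `w` of `K` over
`𝕍(F)^bad`, `e(w|p) ≥ l` — `2l ∣ ord_w(q) = e(w|v)·ord_v(q_v)` with `gcd(l, ord_v(q_v)) = 1`, [IUTchI] Def. 3.1 (c) / Ex. 3.2 (iv) as typed in
`InitialThetaData`) and abc-iut-C-cert-3's `Cor312Prov.mem_pilotDataOfK_S_iff`.

WHAT IT SETTLES (SLICE.md v0.5 row 5 «scope EMPTY for l > (p−2)/e_v; vacuous for l ≫ 0»; abc-iut-rh-tst-5 g3 23:45:56Z (ii) «Σ₅ omits EVERY bad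
odd prime p < l + 2 wholesale»; READING v1.2 §Q3 «Row 5: YES-VACUOUS (tame scope empties)») — as THEOREMS about the stratum of record, for every
collection of initial Θ-data `D` (no table, no family):
* `l_le_ramificationIdx_placeOf_of_mem_S` — at every BAD fibre point `w ∣ p` of the genuine datum `pilotDataOfK D K`: `l ≤ e_w`;
* `not_uniformlyTameAt_of_mem_S_of_le` — a prime `p ≤ l + 1` under a bad place is NOT uniformly tame (`e_w ≤ p − 2 ≤ l − 1 < l`);
  `not_uniformlyBallAt_of_mem_S_of_le` — a prime `p ≤ l` under a bad place is NOT uniformly ball (`e_w ≤ p − 1 ≤ l − 1 < l`);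
* `not_mem_sigmaFive_of_mem_S_of_le` / `not_mem_sigmaFiveBall_of_mem_S_of_le` — hence EVERY label of such a packet is OFF Σ₅ (resp. Σ₅♭):
  the packet column is EMPTY (`J_p = 0` in `exists_sliceBoundary_sigmaFive`), whatever the cells say;
* `mem_sigmaFive_inr_iff_forall_not_mem_S_of_forall_le` — if EVERY bad prime of the datum is `≤ l + 1` (e.g. `l ≥` the largest bad prime: the
  «l ≫ 0» regime of Q3 at a fixed datum), then the prime packets of Σ₅ are EXACTLY the bad-place-free ones at every label: row 5's licence
  certifies NO bad packet at all there — the capacity class «vacuous for l ≫ 0» of SLICE.md, in kernel; the same for Σ₅♭ with `≤ l`.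
So inside [IUTchIV] Cor. 2.2 (ii)'s prime window `l ≥ √(log q∀)` the only bad packets row 5 can ever certify sit over primes `p ≥ l + 2`
(necessarily with `e_w ≤ p − 2`, hence tame AND with `H_p ≤ 4` at the top label by `RHTameCellQ3Dichotomy`).
HONEST FRAMING: statements about OUR typed reading predicates at the genuine datum; nothing here asserts that abc is proved or refuted, or that
[IUTchIII] Cor. 3.12 holds or fails anywhere; no side taken on any author; typed ≠ proved. [cite: Mochizuki2012, IUTchI Def. 3.1 (c) p. 62,
Ex. 3.2 (iv) p. 71; IUTchIV Prop. 1.2 (i)(ii) p. 10, Cor. 2.2 (ii) p. 46] [claim: Mochizuki2012, status: disputed] for every IUT sentence quoted.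
Axioms: standard.
-/

noncomputable section
open Set Metric Function NumberField IsDedekindDomain
open scoped Pointwise

namespace Summit.ABC.IUTFork.Repair.RH.TameBandLicenceSigma

open Literature.AnabelianGeometry.AbsoluteAnabelian Literature.IUT.LogThetaLattice Literature.IUT.LogVolume
  Literature.IUT.HodgeTheaters Literature.NumberTheory.NumberFields Literature.NumberTheory.GaloisRepresentations.Ultrametric
open Summit.ABC.IUTFork.Thm311 Summit.ABC.IUTFork.Thm311.Real Summit.ABC.IUTFork.Cor312 Summit.ABC.IUTFork.Cor312.Setting
  Summit.ABC.IUTFork.Cor312Vol Summit.ABC.IUTFork.Cor312Prov Summit.ABC.IUTFork.Repair.RH.TameBandLicence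
  Summit.ABC.IUTFork.Repair.RH.SigmaLicence Summit.ABC.IUTFork.Repair.RH.TameBandLicenceSigmaBall

variable {F K Fbar : Type} [Field F] [NumberField F] [Field K] [NumberField K] [Algebra F K] [Field Fbar]
  [Algebra F Fbar] [Algebra K Fbar] {E : WeierstrassCurve F} [E.IsElliptic] {l : ℕ} {Pb : BadPlacePredicates K}
  (D : InitialThetaData F K Fbar E l Pb)

/-! ## §1. `e_w ≥ l` at every bad fibre point of the genuine datum -/

/-- **`l ≤ e_w` at every BAD fibre point** `w ∣ p` of `pilotDataOfK D K` (abc-iut-w5-d054's `l_le_ramificationIdx_int_of_over_VFbad` through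
abc-iut-C-cert-3's `mem_pilotDataOfK_S_iff`: the bad places of the `K`-level datum are exactly the places over `𝕍(F)^bad`).
[cite: Mochizuki2012, IUTchI Ex. 3.2 (iv) p. 71] [claim: Mochizuki2012, status: disputed] -/
theorem l_le_ramificationIdx_placeOf_of_mem_S (pp : Nat.Primes) (w : (thetaIndex (pilotDataOfK D K)).Fibre (.inr pp))
    (hw : haveI : Fact (pp : ℕ).Prime := ⟨pp.2⟩; placeOf (pilotDataOfK D K) pp.1 w ∈ (pilotDataOfK D K).S) :
    haveI : Fact (pp : ℕ).Prime := ⟨pp.2⟩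
    l ≤ (placeOf (pilotDataOfK D K) pp.1 w).asIdeal.ramificationIdx ℤ := by
  haveI : Fact (pp : ℕ).Prime := ⟨pp.2⟩
  exact l_le_ramificationIdx_int_of_over_VFbad D _ ((mem_pilotDataOfK_S_iff D K _).mp hw)

/-! ## §2. Small bad primes are never uniformly tame / ball -/

/-- **A prime `p ≤ l + 1` under a BAD place is NOT uniformly tame** (`UniformlyTameAt` needs `e_w ≤ p − 2 ≤ l − 1`, but `e_w ≥ l`).
[claim: Mochizuki2012, status: disputed] -/
theorem not_uniformlyTameAt_of_mem_S_of_le (pp : Nat.Primes) (w : (thetaIndex (pilotDataOfK D K)).Fibre (.inr pp))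
    (hw : haveI : Fact (pp : ℕ).Prime := ⟨pp.2⟩; placeOf (pilotDataOfK D K) pp.1 w ∈ (pilotDataOfK D K).S)
    (hp : (pp : ℕ) ≤ l + 1) : ¬ UniformlyTameAt D pp := by
  haveI : Fact (pp : ℕ).Prime := ⟨pp.2⟩
  rintro ⟨hp2, e, hep, he⟩
  have h1 := l_le_ramificationIdx_placeOf_of_mem_S D pp w hw
  rw [he w] at h1
  omega

/-- **A prime `p ≤ l` under a BAD place is NOT uniformly ball** (`UniformlyBallAt` needs `e_w ≤ p − 1 ≤ l − 1`, but `e_w ≥ l`).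
[claim: Mochizuki2012, status: disputed] -/
theorem not_uniformlyBallAt_of_mem_S_of_le (pp : Nat.Primes) (w : (thetaIndex (pilotDataOfK D K)).Fibre (.inr pp))
    (hw : haveI : Fact (pp : ℕ).Prime := ⟨pp.2⟩; placeOf (pilotDataOfK D K) pp.1 w ∈ (pilotDataOfK D K).S)
    (hp : (pp : ℕ) ≤ l) : ¬ UniformlyBallAt D pp := by
  haveI : Fact (pp : ℕ).Prime := ⟨pp.2⟩
  rintro ⟨hp2, e, hep, he⟩
  have h1 := l_le_ramificationIdx_placeOf_of_mem_S D pp w hw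
  rw [(he w).1] at h1
  omega

/-! ## §3. Hence such packets are OFF Σ₅ / Σ₅♭ at EVERY label -/

/-- **Every label of a packet over a bad prime `p ≤ l + 1` is OFF Σ₅** (the packet column of `exists_sliceBoundary_sigmaFive` is empty).
[claim: Mochizuki2012, status: disputed] -/
theorem not_mem_sigmaFive_of_mem_S_of_le (i : Fin (thetaIndex (pilotDataOfK D K)).lstar) (pp : Nat.Primes)
    (w : (thetaIndex (pilotDataOfK D K)).Fibre (.inr pp))
    (hw : haveI : Fact (pp : ℕ).Prime := ⟨pp.2⟩; placeOf (pilotDataOfK D K) pp.1 w ∈ (pilotDataOfK D K).S)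
    (hp : (pp : ℕ) ≤ l + 1) : (i, Sum.inr pp) ∉ sigmaFive D := by
  haveI : Fact (pp : ℕ).Prime := ⟨pp.2⟩
  intro h
  rw [mem_sigmaFive_inr_iff] at h
  rcases h with h | ⟨htame, -⟩
  · exact h w hw
  · exact not_uniformlyTameAt_of_mem_S_of_le D pp w hw hp htame

/-- **Every label of a packet over a bad prime `p ≤ l` is OFF Σ₅♭.** [claim: Mochizuki2012, status: disputed] -/
theorem not_mem_sigmaFiveBall_of_mem_S_of_le (i : Fin (thetaIndex (pilotDataOfK D K)).lstar) (pp : Nat.Primes)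
    (w : (thetaIndex (pilotDataOfK D K)).Fibre (.inr pp))
    (hw : haveI : Fact (pp : ℕ).Prime := ⟨pp.2⟩; placeOf (pilotDataOfK D K) pp.1 w ∈ (pilotDataOfK D K).S)
    (hp : (pp : ℕ) ≤ l) : (i, Sum.inr pp) ∉ sigmaFiveBall D := by
  haveI : Fact (pp : ℕ).Prime := ⟨pp.2⟩
  intro h
  rw [mem_sigmaFiveBall_inr_iff] at h
  rcases h with h | ⟨hball, -⟩
  · exact h w hw
  · exact not_uniformlyBallAt_of_mem_S_of_le D pp w hw hp hball

/-! ## §4. «Vacuous for l ≫ 0»: when every bad prime is `≤ l + 1`, Σ₅ certifies exactly the bad-place-free packets -/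

/-- **If every bad prime of the datum is `≤ l + 1`, the prime packets of Σ₅ are EXACTLY the bad-place-free ones, at every label** — row 5's
licence then certifies no bad packet at all (SLICE.md row 5 «vacuous for l ≫ 0»; READING §Q3 «Row 5: YES-VACUOUS»).
[claim: Mochizuki2012, status: disputed] -/
theorem mem_sigmaFive_inr_iff_forall_not_mem_S_of_forall_le
    (hall : ∀ (pp : Nat.Primes) (w : (thetaIndex (pilotDataOfK D K)).Fibre (.inr pp)),
      haveI : Fact (pp : ℕ).Prime := ⟨pp.2⟩; placeOf (pilotDataOfK D K) pp.1 w ∈ (pilotDataOfK D K).S → (pp : ℕ) ≤ l + 1)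
    (i : Fin (thetaIndex (pilotDataOfK D K)).lstar) (pp : Nat.Primes) :
    (i, Sum.inr pp) ∈ sigmaFive D ↔
      haveI : Fact (pp : ℕ).Prime := ⟨pp.2⟩
      ∀ w : (thetaIndex (pilotDataOfK D K)).Fibre (.inr pp), placeOf (pilotDataOfK D K) pp.1 w ∉ (pilotDataOfK D K).S := by
  haveI : Fact (pp : ℕ).Prime := ⟨pp.2⟩
  constructor
  · intro h w hw
    exact not_mem_sigmaFive_of_mem_S_of_le D i pp w hw (hall pp w hw) h
  · intro h
    exact (mem_sigmaFive_inr_iff D i pp).2 (Or.inl h)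

/-- **The same for the ball scope Σ₅♭ when every bad prime is `≤ l`.** [claim: Mochizuki2012, status: disputed] -/
theorem mem_sigmaFiveBall_inr_iff_forall_not_mem_S_of_forall_le
    (hall : ∀ (pp : Nat.Primes) (w : (thetaIndex (pilotDataOfK D K)).Fibre (.inr pp)),
      haveI : Fact (pp : ℕ).Prime := ⟨pp.2⟩; placeOf (pilotDataOfK D K) pp.1 w ∈ (pilotDataOfK D K).S → (pp : ℕ) ≤ l)
    (i : Fin (thetaIndex (pilotDataOfK D K)).lstar) (pp : Nat.Primes) :
    (i, Sum.inr pp) ∈ sigmaFiveBall D ↔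
      haveI : Fact (pp : ℕ).Prime := ⟨pp.2⟩
      ∀ w : (thetaIndex (pilotDataOfK D K)).Fibre (.inr pp), placeOf (pilotDataOfK D K) pp.1 w ∉ (pilotDataOfK D K).S := by
  haveI : Fact (pp : ℕ).Prime := ⟨pp.2⟩
  constructor
  · intro h w hw
    exact not_mem_sigmaFiveBall_of_mem_S_of_le D i pp w hw (hall pp w hw) h
  · intro h
    exact (mem_sigmaFiveBall_inr_iff D i pp).2 (Or.inl h)

/-- **Contrapositive reading for the window**: a prime packet over a BAD place that IS in Σ₅ at some label lies over a prime `p ≥ l + 2`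
(so inside Cor. 2.2 (ii)'s window `l ≥ √(log q∀)` row 5 certifies only bad primes `p ≥ √(log q∀) + 2`). [claim: Mochizuki2012, status: disputed] -/
theorem le_prime_of_mem_sigmaFive_of_mem_S (i : Fin (thetaIndex (pilotDataOfK D K)).lstar) (pp : Nat.Primes)
    (w : (thetaIndex (pilotDataOfK D K)).Fibre (.inr pp))
    (hw : haveI : Fact (pp : ℕ).Prime := ⟨pp.2⟩; placeOf (pilotDataOfK D K) pp.1 w ∈ (pilotDataOfK D K).S)
    (h : (i, Sum.inr pp) ∈ sigmaFive D) : l + 2 ≤ (pp : ℕ) := by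
  by_contra hlt
  exact not_mem_sigmaFive_of_mem_S_of_le D i pp w hw (by omega) h

end Summit.ABC.IUTFork.Repair.RH.TameBandLicenceSigma

end
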